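import Mathlib.Analysis.Distribution.AEEqOfIntegralContDiff
import Mathlib.MeasureTheory.Function.L2Space
import Literature.Analysis.FluidPDE.CaloricDuhamelRepresentation
import Literature.Analysis.FluidPDE.CaloricTestFieldCalculus
import Literature.Analysis.FluidPDE.CaloricTruncatedKernels
import Literature.Analysis.FluidPDE.WholeSpaceIBP
import HarnessLib

/-!
# Duality for the heat equation with divergence-form right-hand side

Analysis/FluidPDE support file (everything proved) for the discharge of the named fact
`Literature.Analysis.FluidPDE.HeatDivFormInteriorImprovement` (`NSBoundedVorticityReduction.lean`;
Robinson–Rodrigo–Sadowski 2016, proof of Thm. 13.7, §13.3.2 Steps 1–2 with App. D). The printed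
argument localises a distributional solution `w` of `∂ₜw - Δw = div g` on a cylinder `Q` with a
cut-off `φ ∈ C_c^∞(Q)` — (13.11): `∂ₜW - ΔW = φ(∂ₜw - Δw) + (∂ₜφ - Δφ)w - 2∇φ·∇w`,
`-2∇φ·∇w = -2∂ⱼ((∂ⱼφ)w) + 2(Δφ)w` — and then *represents* `W = φw` by Duhamel's formula (D.2),
`W = (∂ₜ - Δ)⁻¹(div G + F)`, to which the heat-kernel estimates of Thms. D.6–D.7 apply. The book
takes the representation for granted (uniqueness, App. D.1); here it is **proved by duality** with
the backward caloric Duhamel integral `U = 𝒰[Θ]` (`heatDuhamelBack 1 Θ`, `∂ₛU + ΔU = -Θ`) of a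
test function `Θ`:

* `heatDivForm_duality` — testing the weak equation with `ψ = φU ∈ C_c^∞(Q)` and expanding
  `∂ₜψ + Δψ = (∂ₜφ + Δφ)U - φΘ + 2Σᵢ∂ᵢφ∂ᵢU`, `⟪g, ∇ψ⟫ = φΣᵢgᵢ∂ᵢU + U⟪g, ∇φ⟫` gives
  `∫ φwΘ = ∫ F U + Σᵢ ∫ Gᵢ ∂ᵢU` with `F = w(∂ₜφ + Δφ) - ⟪g, ∇φ⟫`, `Gᵢ = 2w∂ᵢφ - φgᵢ`
  (this is (13.11)–(13.12) in weak form);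
* `integral_mul_heatDuhamelBack_eq_integral_mul_convolution` /
  `integral_mul_fderiv_heatDuhamelBack_eq_integral_mul_convolution` — `U` and `∂ᵢU` are space–time
  potentials of `Θ` against the backward heat kernel and its gradient (accepted
  `CaloricDuhamelRepresentation`); on data supported in times `> T₋` and test functions supported
  in times `< T₊` only time lags `< T = T₊ - T₋` occur, so the kernels may be truncated to the
  strip `(-T, 0)` (`CaloricTruncatedKernels`), and Fubini (`integral_mul_convolution_comm`, with the
  absolute convergence `integrable_kernelPairing_of_integrable` for `L¹` data, `L¹` kernel and
  bounded test function) moves the potential onto the data: `∫ f U = ∫ Θ (ǩ_T ⋆ f)`;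
* `ae_eq_on_of_forall_isSpaceTimeTestOn` — two locally integrable functions with the same
  pairings against all `C_c^∞(Q)` test functions agree a.e. on `Q` (Mathlib's
  `IsOpen.ae_eq_zero_of_integral_contDiff_smul_eq_zero`).

Together: `φw = ǩ_T ⋆ F + Σᵢ ǩ_{i,T} ⋆ Gᵢ` a.e. on `Q` — the Duhamel representation (D.2) of the
localised solution — after which Young's inequality gives the `L^r` bound (next file).

## References

* J. C. Robinson, J. L. Rodrigo, W. Sadowski, *The Three-Dimensional Navier–Stokes Equations*,
  CUP 2016: §13.3.2 Step 1 (13.11)–(13.12) (pp. 185–186), App. D (D.2), Thms. D.6–D.7.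
  [`RobinsonRodrigoSadowskiCUP2016`]
* L. C. Evans, *Partial Differential Equations*, 2nd ed., §2.3.1 Thm. 2 (Duhamel's principle).
-/

noncomputable section

open MeasureTheory Set Function Filter TopologicalSpace ContinuousLinearMap
open scoped ENNReal NNReal Topology RealInnerProductSpace Laplacian Convolution

namespace Literature.Analysis.FluidPDE

variable {E : Type*} [NormedAddCommGroup E] [InnerProductSpace ℝ E] [FiniteDimensional ℝ E]
  [MeasurableSpace E] [BorelSpace E]

/-! ### Supports and integrability of cut-off products -/

omit [InnerProductSpace ℝ E] [FiniteDimensional ℝ E] [MeasurableSpace E] [BorelSpace E] in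
/-- Off the support of the uncurried field the slice support is avoided too. [folklore] -/
theorem notMem_tsupport_slice_of_notMem_uncurry {ψ : ℝ → E → ℝ} {t : ℝ} {x : E}
    (h : (t, x) ∉ tsupport (uncurry ψ)) : x ∉ tsupport (ψ t) := by
  intro hx
  apply h
  have hsub : tsupport (ψ t) ⊆ (fun y => (t, y)) ⁻¹' tsupport (uncurry ψ) :=
    closure_minimal (fun y hy => subset_tsupport _ (by simpa using hy))
      ((isClosed_tsupport _).preimage (Continuous.prodMk_right t))
  exact hsub hx

/-- **Integrability of a cut-off product**: `w · B` is integrable on `ℝ × E` when `w` is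
integrable on a measurable `S`, `B` is continuous and vanishes off a compact `K ⊆ S`. [folklore] -/
theorem integrable_mul_of_continuous_of_eq_zero_off {S K : Set (ℝ × E)} (hK : IsCompact K)
    (hKS : K ⊆ S) {w B : ℝ × E → ℝ} (hw : IntegrableOn w S volume) (hB : Continuous B)
    (hB0 : ∀ q, q ∉ K → B q = 0) :
    Integrable (fun q => w q * B q) (volume : Measure (ℝ × E)) := by
  have hBc : HasCompactSupport B := HasCompactSupport.intro hK hB0
  obtain ⟨C, hC⟩ := hB.bounded_above_of_compact_support hBc
  have h1 : Integrable (fun q => w q * B q) ((volume : Measure (ℝ × E)).restrict S) :=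
    hw.mul_bdd hB.aestronglyMeasurable (ae_of_all _ hC)
  refine (integrableOn_iff_integrable_of_support_subset (μ := volume) (s := S) ?_).1 h1
  intro q hq
  by_contra hqS
  exact hq (by simp [hB0 q fun hqK => hqS (hKS hqK)])

/-- **Integrability of a cut-off pairing**: `⟪g, V⟫` is integrable on `ℝ × E` when `g` is
integrable on a measurable `S`, `V` is continuous and vanishes off a compact `K ⊆ S`. [folklore] -/
theorem integrable_inner_of_continuous_of_eq_zero_off {S K : Set (ℝ × E)} (hK : IsCompact K)
    (hKS : K ⊆ S) {g V : ℝ × E → E} (hg : IntegrableOn g S volume) (hV : Continuous V)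
    (hV0 : ∀ q, q ∉ K → V q = 0) :
    Integrable (fun q => ⟪g q, V q⟫) (volume : Measure (ℝ × E)) := by
  have hVc : HasCompactSupport V := HasCompactSupport.intro hK hV0
  obtain ⟨C, hC⟩ := hV.bounded_above_of_compact_support hVc
  have h1 : Integrable (fun q => ⟪g q, V q⟫) ((volume : Measure (ℝ × E)).restrict S) := by
    refine Integrable.mono' (hg.norm.mul_const C) (hg.1.inner hV.aestronglyMeasurable) ?_
    refine ae_of_all _ fun q => ?_
    calc ‖⟪g q, V q⟫‖ ≤ ‖g q‖ * ‖V q‖ := norm_inner_le_norm _ _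
      _ ≤ ‖g q‖ * C := by gcongr; exact hC q
  refine (integrableOn_iff_integrable_of_support_subset (μ := volume) (s := S) ?_).1 h1
  intro q hq
  by_contra hqS
  exact hq (by simp [hV0 q fun hqK => hqS (hKS hqK)])

/-! ### The duality identity -/

/-- **Weak localisation identity (Robinson–Rodrigo–Sadowski 2016, (13.11)–(13.12), tested against
the backward caloric Duhamel integral).** Let `w ∈ L¹(Q)`, `g ∈ L¹(Q; E)` satisfy
`∂ₜw - Δw = div g` in `𝒟'(Q)`, i.e. `∫ w(∂ₜψ + Δψ) = ∫ ⟪g, ∇ψ⟫` for all `ψ ∈ C_c^∞(Q)`, let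
`φ ∈ C_c^∞(Q)` and let `Θ` be a space–time test function with `U = 𝒰[Θ] = heatDuhamelBack 1 Θ`
(`∂ₛU + ΔU = -Θ`). Then, for any orthonormal basis `(bᵢ)`,
`∫ φ w Θ = ∫ (w(∂ₜφ + Δφ) - ⟪g, ∇φ⟫) U + Σᵢ ∫ (2w ∂ᵢφ - φ gᵢ) ∂ᵢU`
(test with `ψ = φU`: `∂ₜψ + Δψ = (∂ₜφ + Δφ)U - φΘ + 2Σᵢ∂ᵢφ∂ᵢU`,
`⟪g, ∇ψ⟫ = φ Σᵢ gᵢ∂ᵢU + U⟪g, ∇φ⟫`). [cite: RobinsonRodrigoSadowskiCUP2016, §13.3.2 Step 1, (13.11)–(13.12) (pp. 185–186)] -/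
theorem heatDivForm_duality {ι : Type*} [Fintype ι] (b : OrthonormalBasis ι ℝ E)
    {Q : Opens (ℝ × E)} {w : ℝ × E → ℝ} {g : ℝ × E → E}
    (hw : IntegrableOn w (Q : Set (ℝ × E)) volume) (hg : IntegrableOn g (Q : Set (ℝ × E)) volume)
    (heq : ∀ ψ : ℝ → E → ℝ, IsSpaceTimeTestOn Q ψ →
      ∫ q : ℝ × E, w q * (timeDeriv ψ q.1 q.2 + (Δ (ψ q.1)) q.2) =
        ∫ q : ℝ × E, ⟪g q, gradient (ψ q.1) q.2⟫)
    {φ : ℝ → E → ℝ} (hφ : IsSpaceTimeTestOn Q φ) {Θ : ℝ → E → ℝ}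
    (hΘ : IsSpaceTimeTestOn (⊤ : Opens (ℝ × E)) Θ) :
    ∫ q : ℝ × E, φ q.1 q.2 * w q * Θ q.1 q.2 =
      (∫ q : ℝ × E, (w q * (timeDeriv φ q.1 q.2 + (Δ (φ q.1)) q.2) -
          ⟪g q, gradient (φ q.1) q.2⟫) * heatDuhamelBack 1 Θ q.1 q.2) +
      ∑ i, ∫ q : ℝ × E, (2 * w q * fderiv ℝ (φ q.1) q.2 (b i) - φ q.1 q.2 * ⟪g q, b i⟫) *
          fderiv ℝ (heatDuhamelBack 1 Θ q.1) q.2 (b i) := by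
  set U : ℝ → E → ℝ := heatDuhamelBack 1 Θ with hU_def
  have hφ' : IsSpaceTimeTestOn (⊤ : Opens (ℝ × E)) φ := hφ.mono le_top
  have hUs : ContDiff ℝ ((⊤ : ℕ∞) : WithTop ℕ∞) (uncurry U) :=
    hΘ.contDiff_uncurry_heatDuhamelBack_infty one_pos
  have hφs : ContDiff ℝ ((⊤ : ℕ∞) : WithTop ℕ∞) (uncurry φ) := hφ.contDiff
  -- the support of the cut-off and its subordinate fields
  set K : Set (ℝ × E) := tsupport (uncurry φ) with hK_def
  have hK : IsCompact K := hφ.hasCompactSupport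
  have hKQ : K ⊆ (Q : Set (ℝ × E)) := hφ.tsupport_subset
  -- the directional derivatives of `U` are jointly continuous (they are Duhamel integrals)
  have hR : ∀ i, Continuous fun q : ℝ × E => fderiv ℝ (U q.1) q.2 (b i) := by
    intro i
    have h1 : (fun q : ℝ × E => fderiv ℝ (U q.1) q.2 (b i)) =
        uncurry (heatDuhamelBack 1 (fun t y => fderiv ℝ (Θ t) y (b i))) := by
      funext q
      exact hΘ.fderiv_heatDuhamelBack_apply one_pos q.1 q.2 (b i)
    rw [h1]
    exact ((hΘ.fderiv_apply_top (b i)).contDiff_uncurry_heatDuhamelBack_infty one_pos).continuous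
  have hUc : Continuous fun q : ℝ × E => U q.1 q.2 := hUs.continuous
  have hΘc : Continuous fun q : ℝ × E => Θ q.1 q.2 := hΘ.contDiff.continuous
  have hφc : Continuous fun q : ℝ × E => φ q.1 q.2 := hφs.continuous
  have hP : ∀ i, Continuous fun q : ℝ × E => fderiv ℝ (φ q.1) q.2 (b i) := fun i =>
    (hφ'.fderiv_apply_top (b i)).contDiff.continuous
  have hgradφ : Continuous fun q : ℝ × E => gradient (φ q.1) q.2 := by
    have h1 : (fun q : ℝ × E => gradient (φ q.1) q.2) =
        fun q => (InnerProductSpace.toDual ℝ E).symm (fderiv ℝ (φ q.1) q.2) := rfl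
    rw [h1]
    exact (InnerProductSpace.toDual ℝ E).symm.continuous.comp hφ'.fderiv_top.contDiff.continuous
  have hFφ : Continuous fun q : ℝ × E => timeDeriv φ q.1 q.2 + (Δ (φ q.1)) q.2 :=
    hφ'.timeDeriv_top.contDiff.continuous.add hφ'.laplacian_top.contDiff.continuous
  -- vanishing off `K`
  have hφ0 : ∀ q : ℝ × E, q ∉ K → φ q.1 q.2 = 0 := fun q hq =>
    image_eq_zero_of_notMem_tsupport (f := uncurry φ) hq
  have hP0 : ∀ i, ∀ q : ℝ × E, q ∉ K → fderiv ℝ (φ q.1) q.2 (b i) = 0 := fun i q hq => by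
    rw [IsSpaceTimeTestOn.fderiv_slice_eq_zero_of_notMem hq]; rfl
  have hgrad0 : ∀ q : ℝ × E, q ∉ K → gradient (φ q.1) q.2 = 0 := fun q hq =>
    gradient_eq_zero_of_notMem_tsupport (notMem_tsupport_slice_of_notMem_uncurry hq)
  have hFφ0 : ∀ q : ℝ × E, q ∉ K → timeDeriv φ q.1 q.2 + (Δ (φ q.1)) q.2 = 0 := fun q hq => by
    rw [IsSpaceTimeTestOn.timeDeriv_eq_zero_of_notMem hq,
      laplacian_eq_zero_of_notMem_tsupport (notMem_tsupport_slice_of_notMem_uncurry hq), add_zero]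
  -- the test function `ψ = φ U`
  have hψ : IsSpaceTimeTestOn Q (fun t x => φ t x * U t x) := hφ.mul_smooth hUs
  have key := heq _ hψ
  -- pointwise expansion of the left integrand
  have hL : ∀ q : ℝ × E,
      w q * (timeDeriv (fun t x => φ t x * U t x) q.1 q.2 + (Δ ((fun t x => φ t x * U t x) q.1)) q.2) =
        w q * ((timeDeriv φ q.1 q.2 + (Δ (φ q.1)) q.2) * U q.1 q.2) -
          w q * (φ q.1 q.2 * Θ q.1 q.2) +
          w q * (2 * ∑ i, fderiv ℝ (φ q.1) q.2 (b i) * fderiv ℝ (U q.1) q.2 (b i)) := by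
    intro q
    have hφd := differentiableAt_time_of_uncurry hφs (by simp) q.1 q.2
    have hUd := differentiableAt_time_of_uncurry hUs (by simp) q.1 q.2
    have hφ2 : ContDiff ℝ 2 (φ q.1) := (contDiff_slice_of_uncurry hφs q.1).of_le two_le_infty
    have hU2 : ContDiff ℝ 2 (U q.1) := (contDiff_slice_of_uncurry hUs q.1).of_le two_le_infty
    have hheat : timeDeriv U q.1 q.2 + (Δ (U q.1)) q.2 = -Θ q.1 q.2 :=
      timeDeriv_add_laplacian_heatDuhamelBack_one hΘ q.1 q.2
    have h1 : timeDeriv (fun t x => φ t x * U t x) q.1 q.2 =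
        timeDeriv φ q.1 q.2 * U q.1 q.2 + φ q.1 q.2 * timeDeriv U q.1 q.2 := timeDeriv_mul hφd hUd
    have h2 : (Δ ((fun t x => φ t x * U t x) q.1)) q.2 =
        φ q.1 q.2 * (Δ (U q.1)) q.2 + U q.1 q.2 * (Δ (φ q.1)) q.2 +
          2 * ∑ i, fderiv ℝ (φ q.1) q.2 (b i) * fderiv ℝ (U q.1) q.2 (b i) :=
      laplacian_mul_eq b hφ2 hU2 q.2
    rw [h1, h2]
    have h3 : (Δ (U q.1)) q.2 = -Θ q.1 q.2 - timeDeriv U q.1 q.2 := by linarith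
    rw [h3]
    ring
  have hsum : ∀ q : ℝ × E,
      w q * (2 * ∑ i, fderiv ℝ (φ q.1) q.2 (b i) * fderiv ℝ (U q.1) q.2 (b i)) =
        2 * ∑ i, w q * (fderiv ℝ (φ q.1) q.2 (b i) * fderiv ℝ (U q.1) q.2 (b i)) := by
    intro q
    rw [Finset.mul_sum, Finset.mul_sum, Finset.mul_sum]
    exact Finset.sum_congr rfl fun i _ => by ring
  -- pointwise expansion of the right integrand
  have hRt : ∀ q : ℝ × E, ⟪g q, gradient ((fun t x => φ t x * U t x) q.1) q.2⟫ =
      ∑ i, ⟪g q, b i⟫ * (φ q.1 q.2 * fderiv ℝ (U q.1) q.2 (b i)) +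
        ⟪g q, U q.1 q.2 • gradient (φ q.1) q.2⟫ := by
    intro q
    have hφd : DifferentiableAt ℝ (φ q.1) q.2 :=
      ((contDiff_slice_of_uncurry hφs q.1).differentiable (by simp)) q.2
    have hUd : DifferentiableAt ℝ (U q.1) q.2 :=
      ((contDiff_slice_of_uncurry hUs q.1).differentiable (by simp)) q.2
    rw [real_inner_smul_right, inner_gradient_right, inner_gradient_right]
    simp only [RCLike.conj_to_real]
    rw [fderiv_fun_mul hφd hUd]
    simp only [_root_.add_apply, FunLike.coe_smul, Pi.smul_apply, smul_eq_mul]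
    rw [fderiv_apply_eq_sum_inner b (U q.1) q.2 (g q), Finset.mul_sum]
    congr 1
    exact Finset.sum_congr rfl fun i _ => by ring
  -- integrability of the pieces
  have iA1 : Integrable (fun q : ℝ × E =>
      w q * ((timeDeriv φ q.1 q.2 + (Δ (φ q.1)) q.2) * U q.1 q.2)) volume :=
    integrable_mul_of_continuous_of_eq_zero_off hK hKQ hw (hFφ.mul hUc)
      fun q hq => by rw [hFφ0 q hq, zero_mul]
  have iA2 : Integrable (fun q : ℝ × E => w q * (φ q.1 q.2 * Θ q.1 q.2)) volume :=
    integrable_mul_of_continuous_of_eq_zero_off hK hKQ hw (hφc.mul hΘc)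
      fun q hq => by rw [hφ0 q hq, zero_mul]
  have iA3 : ∀ i, Integrable (fun q : ℝ × E =>
      w q * (fderiv ℝ (φ q.1) q.2 (b i) * fderiv ℝ (U q.1) q.2 (b i))) volume := fun i =>
    integrable_mul_of_continuous_of_eq_zero_off hK hKQ hw ((hP i).mul (hR i))
      fun q hq => by rw [hP0 i q hq, zero_mul]
  have iA4 : ∀ i, Integrable (fun q : ℝ × E =>
      ⟪g q, b i⟫ * (φ q.1 q.2 * fderiv ℝ (U q.1) q.2 (b i))) volume := fun i =>
    integrable_mul_of_continuous_of_eq_zero_off hK hKQ (hg.inner_const (b i)) (hφc.mul (hR i))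
      fun q hq => by rw [hφ0 q hq, zero_mul]
  have iA5 : Integrable (fun q : ℝ × E => ⟪g q, U q.1 q.2 • gradient (φ q.1) q.2⟫) volume :=
    integrable_inner_of_continuous_of_eq_zero_off hK hKQ hg (hUc.smul hgradφ)
      fun q hq => by rw [hgrad0 q hq, smul_zero]
  -- evaluate both sides of `key`
  have i12 : Integrable (fun q : ℝ × E =>
      w q * ((timeDeriv φ q.1 q.2 + (Δ (φ q.1)) q.2) * U q.1 q.2) -
        w q * (φ q.1 q.2 * Θ q.1 q.2)) volume := iA1.sub iA2
  have i3s : Integrable (fun q : ℝ × E =>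
      2 * ∑ i, w q * (fderiv ℝ (φ q.1) q.2 (b i) * fderiv ℝ (U q.1) q.2 (b i))) volume :=
    (integrable_finsetSum _ fun i _ => iA3 i).const_mul 2
  have hL' : ∀ q : ℝ × E,
      w q * (timeDeriv (fun t x => φ t x * U t x) q.1 q.2 + (Δ ((fun t x => φ t x * U t x) q.1)) q.2) =
        (w q * ((timeDeriv φ q.1 q.2 + (Δ (φ q.1)) q.2) * U q.1 q.2) -
          w q * (φ q.1 q.2 * Θ q.1 q.2)) +
          2 * ∑ i, w q * (fderiv ℝ (φ q.1) q.2 (b i) * fderiv ℝ (U q.1) q.2 (b i)) := fun q => by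
    rw [hL q, hsum q]
  have hLint : ∫ q : ℝ × E, w q * (timeDeriv (fun t x => φ t x * U t x) q.1 q.2 +
      (Δ ((fun t x => φ t x * U t x) q.1)) q.2) =
      (∫ q : ℝ × E, w q * ((timeDeriv φ q.1 q.2 + (Δ (φ q.1)) q.2) * U q.1 q.2)) -
        (∫ q : ℝ × E, w q * (φ q.1 q.2 * Θ q.1 q.2)) +
        2 * ∑ i, ∫ q : ℝ × E, w q * (fderiv ℝ (φ q.1) q.2 (b i) * fderiv ℝ (U q.1) q.2 (b i)) := by
    rw [integral_congr_ae (Eventually.of_forall hL'), integral_add i12 i3s, integral_sub iA1 iA2,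
      integral_const_mul, integral_finsetSum _ fun i _ => iA3 i]
  have hRint : ∫ q : ℝ × E, ⟪g q, gradient ((fun t x => φ t x * U t x) q.1) q.2⟫ =
      (∑ i, ∫ q : ℝ × E, ⟪g q, b i⟫ * (φ q.1 q.2 * fderiv ℝ (U q.1) q.2 (b i))) +
        ∫ q : ℝ × E, ⟪g q, U q.1 q.2 • gradient (φ q.1) q.2⟫ := by
    rw [integral_congr_ae (Eventually.of_forall hRt),
      integral_add (integrable_finsetSum _ fun i _ => iA4 i) iA5,
      integral_finsetSum _ fun i _ => iA4 i]
  rw [hLint, hRint] at key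
  -- the two integrals of the statement
  have hFpt : ∀ q : ℝ × E, (w q * (timeDeriv φ q.1 q.2 + (Δ (φ q.1)) q.2) -
      ⟪g q, gradient (φ q.1) q.2⟫) * U q.1 q.2 =
      w q * ((timeDeriv φ q.1 q.2 + (Δ (φ q.1)) q.2) * U q.1 q.2) -
        ⟪g q, U q.1 q.2 • gradient (φ q.1) q.2⟫ := fun q => by
    rw [real_inner_smul_right]; ring
  have hF : ∫ q : ℝ × E, (w q * (timeDeriv φ q.1 q.2 + (Δ (φ q.1)) q.2) -
      ⟪g q, gradient (φ q.1) q.2⟫) * U q.1 q.2 =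
      (∫ q : ℝ × E, w q * ((timeDeriv φ q.1 q.2 + (Δ (φ q.1)) q.2) * U q.1 q.2)) -
        ∫ q : ℝ × E, ⟪g q, U q.1 q.2 • gradient (φ q.1) q.2⟫ := by
    rw [← integral_sub iA1 iA5]
    exact integral_congr_ae (Eventually.of_forall hFpt)
  have hGpt : ∀ i, ∀ q : ℝ × E,
      (2 * w q * fderiv ℝ (φ q.1) q.2 (b i) - φ q.1 q.2 * ⟪g q, b i⟫) * fderiv ℝ (U q.1) q.2 (b i) =
      2 * (w q * (fderiv ℝ (φ q.1) q.2 (b i) * fderiv ℝ (U q.1) q.2 (b i))) -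
        ⟪g q, b i⟫ * (φ q.1 q.2 * fderiv ℝ (U q.1) q.2 (b i)) := fun i q => by ring
  have hG : ∀ i, ∫ q : ℝ × E, (2 * w q * fderiv ℝ (φ q.1) q.2 (b i) - φ q.1 q.2 * ⟪g q, b i⟫) *
      fderiv ℝ (U q.1) q.2 (b i) =
      2 * (∫ q : ℝ × E, w q * (fderiv ℝ (φ q.1) q.2 (b i) * fderiv ℝ (U q.1) q.2 (b i))) -
        ∫ q : ℝ × E, ⟪g q, b i⟫ * (φ q.1 q.2 * fderiv ℝ (U q.1) q.2 (b i)) := by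
    intro i
    rw [← integral_const_mul, ← integral_sub ((iA3 i).const_mul 2) (iA4 i)]
    exact integral_congr_ae (Eventually.of_forall (hGpt i))
  have hWpt : ∀ q : ℝ × E, φ q.1 q.2 * w q * Θ q.1 q.2 = w q * (φ q.1 q.2 * Θ q.1 q.2) :=
    fun q => by ring
  have hW : ∫ q : ℝ × E, φ q.1 q.2 * w q * Θ q.1 q.2 = ∫ q : ℝ × E, w q * (φ q.1 q.2 * Θ q.1 q.2) :=
    integral_congr_ae (Eventually.of_forall hWpt)
  rw [hF, hW, Finset.sum_congr rfl fun i _ => hG i, Finset.sum_sub_distrib, ← Finset.mul_sum]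
  linarith

/-! ### Potentials: truncation of the kernel and the adjoint identity -/

/-- **Only time lags below `T₂ - T₁` occur**: if the datum `θ` vanishes at times `≥ T₂`, then at
every point with time `> T₁` the potential `backKernel κ ⋆ θ` equals the potential of `θ` against
the kernel truncated to the strip `-(T₂ - T₁) < τ < 0`. [folklore] -/
theorem convolution_backKernel_eq_convolution_indicator_strip {κ : ℝ → E → ℝ} {θ : ℝ × E → ℝ}
    {T₁ T₂ : ℝ} (hθ : ∀ p, θ p ≠ 0 → p.1 < T₂) {q : ℝ × E} (hq : T₁ < q.1) :
    (backKernel κ ⋆[lsmul ℝ ℝ, (volume : Measure (ℝ × E))] θ) q =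
      ((Ioo (-(T₂ - T₁)) 0 ×ˢ (univ : Set E)).indicator (backKernel κ) ⋆[lsmul ℝ ℝ,
        (volume : Measure (ℝ × E))] θ) q := by
  rw [convolution_lsmul_real_prod_apply, convolution_lsmul_real_prod_apply]
  refine integral_congr_ae (Eventually.of_forall fun p => ?_)
  show backKernel κ (q - p) * θ p =
    (Ioo (-(T₂ - T₁)) 0 ×ˢ (univ : Set E)).indicator (backKernel κ) (q - p) * θ p
  by_cases hp : θ p = 0
  · simp [hp]
  · rw [indicator_strip_backKernel_of_lt κ]
    have := hθ p hp
    show -(T₂ - T₁) < (q - p).1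
    rw [Prod.fst_sub]
    linarith

/-- **Absolute convergence of the pairing for integrable data**: `f ∈ L¹`, `K ∈ L¹`, `θ` bounded
and measurable give `f(z) K(z - w) θ(w) ∈ L¹` of the product (`‖f‖₁ ‖K‖₁ ‖θ‖_∞`). [folklore] -/
theorem integrable_kernelPairing_of_integrable {K f θ : ℝ × E → ℝ}
    (hK : Integrable K (volume : Measure (ℝ × E))) (hf : Integrable f (volume : Measure (ℝ × E)))
    (hθ : AEStronglyMeasurable θ (volume : Measure (ℝ × E))) {M : ℝ} (hθM : ∀ p, |θ p| ≤ M) :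
    Integrable (fun p : (ℝ × E) × (ℝ × E) => f p.1 * (K (p.1 - p.2) * θ p.2))
      ((volume : Measure (ℝ × E)).prod volume) := by
  haveI := isAddLeftInvariant_volume_real_prod (E := E)
  haveI := isAddRightInvariant_volume_real_prod (E := E)
  haveI := isNegInvariant_volume_real_prod (E := E)
  have hKn : Integrable (fun v => K (-v)) (volume : Measure (ℝ × E)) := hK.comp_neg
  have h1 := hf.convolution_integrand (lsmul ℝ ℝ) hKn
  -- `h1 : Integrable (fun p => f p.2 • K (-(p.1 - p.2))) (volume.prod volume)`; swap the factors
  have h2 : Integrable (fun p : (ℝ × E) × (ℝ × E) => f p.1 * K (p.1 - p.2))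
      ((volume : Measure (ℝ × E)).prod volume) := by
    refine h1.swap.congr (Eventually.of_forall fun p => ?_)
    simp [Function.comp, neg_sub]
  have h3 : Integrable (fun p : (ℝ × E) × (ℝ × E) => (f p.1 * K (p.1 - p.2)) * θ p.2)
      ((volume : Measure (ℝ × E)).prod volume) :=
    h2.mul_bdd hθ.comp_snd (ae_of_all _ fun p => by
      rw [Real.norm_eq_abs]; exact hθM p.2)
  exact h3.congr (Eventually.of_forall fun p => by ring)

/-- **The Duhamel integral moved onto the data** (Robinson–Rodrigo–Sadowski 2016, (D.2), by
duality): for a space–time test function `Θ` supported in times `< T₂`, an integrable datum `f`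
supported in times `> T₁` (`T₁ < T₂`) and `U = 𝒰[Θ] = heatDuhamelBack 1 Θ`,
`∫ f U = ∫ Θ (ǩ_T ⋆ f)` with the forward truncated heat kernel
`ǩ_T(τ, y) = 1_{(-T,0)}(-τ) G_τ(-y)`, `T = T₂ - T₁` (`U = k ⋆ Θ` with the backward kernel,
truncation, Fubini). [cite: RobinsonRodrigoSadowskiCUP2016, App. D (D.2) with Thm. D.6] -/
theorem integral_mul_heatDuhamelBack_eq_integral_mul_convolution
    (hn : 0 < Module.finrank ℝ E) {Θ : ℝ → E → ℝ}
    (hΘ : IsSpaceTimeTestOn (⊤ : Opens (ℝ × E)) Θ) {T₁ T₂ : ℝ} (hT : T₁ < T₂)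
    (hΘT : ∀ p : ℝ × E, Θ p.1 p.2 ≠ 0 → p.1 < T₂) {f : ℝ × E → ℝ}
    (hf : Integrable f (volume : Measure (ℝ × E))) (hfT : ∀ q, f q ≠ 0 → T₁ < q.1) :
    ∫ q : ℝ × E, f q * heatDuhamelBack 1 Θ q.1 q.2 =
      ∫ p : ℝ × E, Θ p.1 p.2 *
        ((fun v => (Ioo (-(T₂ - T₁)) 0 ×ˢ (univ : Set E)).indicator
          (backKernel (UnboundedOperators.heatKernel (E := E))) (-v)) ⋆[lsmul ℝ ℝ,
          (volume : Measure (ℝ × E))] f) p := by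
  set kT : ℝ × E → ℝ := (Ioo (-(T₂ - T₁)) 0 ×ˢ (univ : Set E)).indicator
    (backKernel (UnboundedOperators.heatKernel (E := E))) with hkT_def
  have hθ0 : ∀ p : ℝ × E, uncurry Θ p ≠ 0 → p.1 < T₂ := fun p hp => hΘT p hp
  -- `U = k ⋆ Θ = k_T ⋆ Θ` on the support of `f`
  have h1 : ∀ q : ℝ × E, f q * heatDuhamelBack 1 Θ q.1 q.2 =
      f q * (kT ⋆[lsmul ℝ ℝ, (volume : Measure (ℝ × E))] uncurry Θ) q := by
    intro q
    by_cases hq : f q = 0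
    · simp [hq]
    · rw [heatDuhamelBack_one_eq_convolution_heatKernel hΘ q.1 q.2,
        convolution_backKernel_eq_convolution_indicator_strip hθ0 (hfT q hq)]
  rw [integral_congr_ae (Eventually.of_forall h1)]
  -- Fubini
  have hkT : Integrable kT (volume : Measure (ℝ × E)) := by
    have h := memLp_indicator_strip_backKernel_heatKernel (E := E) (b := 1) le_rfl ENNReal.one_ne_top
      (by
        rw [ENNReal.toReal_one]
        have : (0 : ℝ) < 2 / (Module.finrank ℝ E : ℝ) := by positivity
        linarith) (sub_pos.2 hT)
    exact memLp_one_iff_integrable.1 h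
  obtain ⟨M, -, hM⟩ := hΘ.exists_norm_le
  have hpair := integrable_kernelPairing_of_integrable hkT hf
    hΘ.contDiff.continuous.aestronglyMeasurable (M := M) fun p => by
      rw [← Real.norm_eq_abs]; exact hM p.1 p.2
  exact integral_mul_convolution_comm hpair

/-- **The gradient of the Duhamel integral moved onto the data**: under the same hypotheses,
`∫ f ∂ᵥU = ∫ Θ (ǩ_{v,T} ⋆ f)` with the forward truncated heat-gradient kernel
`ǩ_{v,T}(τ, y) = 1_{(-T,0)}(-τ) ∂ᵥG_τ(-y)` (`∂ᵥU = backKernel (∂ᵥG) ⋆ Θ`, truncation, Fubini).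
[cite: RobinsonRodrigoSadowskiCUP2016, App. D (D.2) with Thm. D.7] -/
theorem integral_mul_fderiv_heatDuhamelBack_eq_integral_mul_convolution (v : E) {Θ : ℝ → E → ℝ}
    (hΘ : IsSpaceTimeTestOn (⊤ : Opens (ℝ × E)) Θ) {T₁ T₂ : ℝ} (hT : T₁ < T₂)
    (hΘT : ∀ p : ℝ × E, Θ p.1 p.2 ≠ 0 → p.1 < T₂) {f : ℝ × E → ℝ}
    (hf : Integrable f (volume : Measure (ℝ × E))) (hfT : ∀ q, f q ≠ 0 → T₁ < q.1) :
    ∫ q : ℝ × E, f q * fderiv ℝ (heatDuhamelBack 1 Θ q.1) q.2 v =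
      ∫ p : ℝ × E, Θ p.1 p.2 *
        ((fun u => (Ioo (-(T₂ - T₁)) 0 ×ˢ (univ : Set E)).indicator
          (backKernel (heatKernelGrad v)) (-u)) ⋆[lsmul ℝ ℝ, (volume : Measure (ℝ × E))] f) p := by
  set kT : ℝ × E → ℝ := (Ioo (-(T₂ - T₁)) 0 ×ˢ (univ : Set E)).indicator
    (backKernel (heatKernelGrad v)) with hkT_def
  have hθ0 : ∀ p : ℝ × E, uncurry Θ p ≠ 0 → p.1 < T₂ := fun p hp => hΘT p hp
  have h1 : ∀ q : ℝ × E, f q * fderiv ℝ (heatDuhamelBack 1 Θ q.1) q.2 v =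
      f q * (kT ⋆[lsmul ℝ ℝ, (volume : Measure (ℝ × E))] uncurry Θ) q := by
    intro q
    by_cases hq : f q = 0
    · simp [hq]
    · rw [fderiv_heatDuhamelBack_one_eq_convolution_heatKernelGrad hΘ q.1 q.2 v,
        convolution_backKernel_eq_convolution_indicator_strip hθ0 (hfT q hq)]
  rw [integral_congr_ae (Eventually.of_forall h1)]
  have hkT : Integrable kT (volume : Measure (ℝ × E)) := by
    have h := memLp_indicator_strip_backKernel_heatKernelGrad (E := E) v (b := 1) le_rfl
      ENNReal.one_ne_top (by
        rw [ENNReal.toReal_one]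
        have : (0 : ℝ) < 1 / ((Module.finrank ℝ E : ℝ) + 1) := by positivity
        linarith) (sub_pos.2 hT)
    exact memLp_one_iff_integrable.1 h
  obtain ⟨M, -, hM⟩ := hΘ.exists_norm_le
  have hpair := integrable_kernelPairing_of_integrable hkT hf
    hΘ.contDiff.continuous.aestronglyMeasurable (M := M) fun p => by
      rw [← Real.norm_eq_abs]; exact hM p.1 p.2
  exact integral_mul_convolution_comm hpair

/-! ### Identification almost everywhere on `Q` -/

/-- **Two locally integrable functions with the same pairings against `C_c^∞(Q)` agree a.e. on
`Q`** (the fundamental lemma of the calculus of variations, Mathlib's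
`IsOpen.ae_eq_zero_of_integral_contDiff_smul_eq_zero`, for space–time test functions in curried
form). [folklore] -/
theorem ae_eq_on_of_forall_isSpaceTimeTestOn {Q : Opens (ℝ × E)} {W V : ℝ × E → ℝ}
    (hW : LocallyIntegrableOn W (Q : Set (ℝ × E)) volume)
    (hV : LocallyIntegrableOn V (Q : Set (ℝ × E)) volume)
    (h : ∀ Θ : ℝ → E → ℝ, IsSpaceTimeTestOn Q Θ →
      ∫ q : ℝ × E, Θ q.1 q.2 * W q = ∫ q : ℝ × E, Θ q.1 q.2 * V q) :
    ∀ᵐ q ∂(volume : Measure (ℝ × E)), q ∈ (Q : Set (ℝ × E)) → W q = V q := by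
  have hWV : LocallyIntegrableOn (fun q => W q - V q) (Q : Set (ℝ × E)) volume := hW.sub hV
  have key := Q.isOpen.ae_eq_zero_of_integral_contDiff_smul_eq_zero (μ := volume) hWV ?_
  · filter_upwards [key] with q hq hqQ
    exact sub_eq_zero.1 (hq hqQ)
  intro θ hθs hθc hθQ
  have hΘ : IsSpaceTimeTestOn Q (curry θ) := by
    refine ⟨?_, ?_, ?_⟩ <;> rw [Function.uncurry_curry]
    exacts [hθs, hθc, hθQ]
  have hK : IsCompact (tsupport θ) := hθc
  have iW : Integrable (fun q => W q * θ q) (volume : Measure (ℝ × E)) :=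
    integrable_mul_of_continuous_of_eq_zero_off hK Subset.rfl
      (hW.integrableOn_compact_subset hθQ hK) hθs.continuous
      fun q hq => image_eq_zero_of_notMem_tsupport hq
  have iV : Integrable (fun q => V q * θ q) (volume : Measure (ℝ × E)) :=
    integrable_mul_of_continuous_of_eq_zero_off hK Subset.rfl
      (hV.integrableOn_compact_subset hθQ hK) hθs.continuous
      fun q hq => image_eq_zero_of_notMem_tsupport hq
  have h' := h (curry θ) hΘ
  simp only [Function.curry_apply, Prod.mk.eta] at h'
  have e1 : ∫ q : ℝ × E, θ q • (W q - V q) = (∫ q : ℝ × E, W q * θ q) - ∫ q : ℝ × E, V q * θ q := by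
    rw [← integral_sub iW iV]
    refine integral_congr_ae (Eventually.of_forall fun q => ?_)
    simp only [smul_eq_mul]; ring
  rw [e1, sub_eq_zero]
  calc ∫ q : ℝ × E, W q * θ q = ∫ q : ℝ × E, θ q * W q :=
        integral_congr_ae (Eventually.of_forall fun q => mul_comm _ _)
    _ = ∫ q : ℝ × E, θ q * V q := h'
    _ = ∫ q : ℝ × E, V q * θ q := integral_congr_ae (Eventually.of_forall fun q => mul_comm _ _)

end Literature.Analysis.FluidPDE
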